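import Summits.ResolutionOfSingularities.ResolutionOfSingularities.Theorems.PurelyInseparableDim4TrapsMeetNonIsolated
import Summits.ResolutionOfSingularities.ResolutionOfSingularities.Theorems.PurelyInseparableDim4TrapsNeedTranslation
import Summits.ResolutionOfSingularities.ResolutionOfSingularities.Theorems.PurelyInseparableDim4WildConesBridge
import HarnessLib
import HarnessLib.Audit.Tags

/-!
# Purely inseparable fourfolds — what every TRAP of the class of record `(p, q) = (2, 2)` must contain
# [OURS · counted 0 · statements about OUR frame, unconditional at `(2,2)`; not about resolution]

Census cell «res-dim4-pi» (D-0157 DOOR 2), width seat `res-dim4-p-14`, brick PR-12q.  Both TIER-1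
statements of frame v4 are now tree theorems at the class of record: F4-S (`spineTerminatesSomeRule_of_pos`,
p-10's capstone over Spivakovsky 1983) and F4-I(2,2) (`WildConesBridge.noIsolatedTrap_two_two`, p-12's
bridge to the WildCones Milnor-number theorem).  Plugging them into PR-12n / PR-12o gives, for EVERY
nonempty trap `T` (`IsTrap 2 T`) over EVERY field of characteristic `2`, unconditionally:

* **`exists_not_isIsolated_two`** — `T` contains a state whose 2-fold origin is NOT isolated;
* **`exists_not_isIsolated_reachable_two`** — from every state of `T` such a state is reached along
  point-blow-up edges inside `T`;
* **`exists_translationForced_two`** — `T` contains a state with a permissible coordinate centre all of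
  whose in-trap answers are TRANSLATED (`b ≠ 0`);
* `not_isolated_spineOnly_two` — so no trap is «all-isolated» and none is «spine-only» (the census'
  two empty cells, EN-9 ISOLATED = 0 on trap states and spine_only = 0 / 595, as theorems).

What remains OPEN is F4-C (a trap all of whose states are IN SCOPE) and TIER 2.  Nothing here proves
resolution of singularities in dimension ≥ 4 / characteristic `p`; counted 0; AI work, weaker than expert
review.
bears_on: LADDER-RESOLUTION:D157-DOOR2 (res-dim4-pi · PR-12q). Supports stmt-ResolutionOfSingularities-16155
(helper).
-/

set_option linter.dupNamespace false

noncomputable section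

namespace Summit.ResolutionOfSingularities.ResolutionOfSingularities.Theorems.PIDim4

namespace TrapsTwoTwo

open Literature.AlgebraicGeometry.Resolution

variable {K : Type} [Field K] [CharP K 2] [DecidableEq K]

/-- **Every `(2,2)` trap contains a NON-ISOLATED state.** [folklore] -/
theorem exists_not_isIsolated_two {T : Set (State K)} (hT : IsTrap 2 T) (hne : T.Nonempty) :
    ∃ s ∈ T, ¬ IsIsolated 2 s.F :=
  TrapsMeetNonIsolated.exists_not_isIsolated_of_isTrap WildConesBridge.noIsolatedTrap_two_two hT hne

/-- **… reachable from every state of the trap along point-blow-up edges inside it.** [folklore] -/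
theorem exists_not_isIsolated_reachable_two {T : Set (State K)} (hT : IsTrap 2 T) {s : State K}
    (hs : s ∈ T) :
    ∃ s' ∈ T, ¬ IsIsolated 2 s'.F ∧ Relation.ReflTransGen (fun a b => b ∈ T ∧ Step0 2 a b) s s' :=
  TrapsMeetNonIsolated.exists_not_isIsolated_reachable_of_isTrap WildConesBridge.noIsolatedTrap_two_two hT hs

/-- **Every `(2,2)` trap has a TRANSLATION-FORCED move.** [folklore] -/
theorem exists_translationForced_two {T : Set (State K)} (hT : IsTrap 2 T) (hne : T.Nonempty) :
    ∃ s ∈ T, ∃ S : Finset (Fin 4), IsPermissibleCentre 2 S s.F ∧ ∀ s' ∈ T, ¬ SpineEdge 2 S s s' :=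
  TrapsNeedTranslation.exists_translationForced_of_isTrap_of_pos (by norm_num) hT hne

/-- Summary: a `(2,2)` trap is neither all-isolated nor spine-only. [folklore] -/
theorem not_isolated_spineOnly_two {T : Set (State K)} (hT : IsTrap 2 T) (hne : T.Nonempty) :
    (¬ ∀ s ∈ T, IsIsolated 2 s.F) ∧
      ¬ ∀ s ∈ T, ∀ S, IsPermissibleCentre 2 S s.F → ∃ s' ∈ T, SpineEdge 2 S s s' := by
  refine ⟨fun hall => ?_, fun hall => ?_⟩
  · obtain ⟨s, hs, hns⟩ := exists_not_isIsolated_two hT hne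
    exact hns (hall s hs)
  · obtain ⟨s, hs, S, hS, hno⟩ := exists_translationForced_two hT hne
    obtain ⟨s', hs', hedge⟩ := hall s hs S hS
    exact hno s' hs' hedge

end TrapsTwoTwo

end Summit.ResolutionOfSingularities.ResolutionOfSingularities.Theorems.PIDim4

end
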